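/-
Copyright: the b2b-balaban T⁴-continuum CRUX team, row NE7b OWNER lineage `t4-ne7b-p1` (gen 147). Project licence.
-/
import Summits.QuantumFields.BalabanUV.T4Continuum.Spine.NE7b.SupWeightedFourthOrderOutputFour
import Summits.QuantumFields.BalabanUV.T4Continuum.Spine.NE7b.SupWeightedFamilyProfiles
import Summits.QuantumFields.BalabanUV.T4Continuum.Spine.NE7b.SupWeightedFamilyProfilesK4
import Summits.QuantumFields.BalabanUV.T4Continuum.Spine.NE7b.SupWeightedProfileDischarge

/-!
# THE WEIGHTED CLASS MAP PACKAGED — ORDER FOUR, DERIVATIVE SLOT `t` (SCOPING-d17 (d14)(3) ∕ SCOPING-d18 §E F20; file (754) of (748)–(762)).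
# The weighted class (SCOPING-d17 §C–§D, the repair of the located NO (648)) carries per order the INTRINSIC full-graph `ϑ₂`-letters of the
# derivative majorants `Hk, K3, K4` in their SLOT shapes; (670) proved the corresponding statement for the OUTPUT of the
# fluctuation step `W⁺(ψ) = −log∫e^{−U(·+ψ)}dμ_{AAᵀ}` at the weaker weight `ϑ` GIVEN the step's PROFILE letters (`αθ, βθ` of the decay
# constants; `αθc, αg1m, αg2m, αg1c, αk4m·, αk4c` of the two-point terms) as hypotheses on `A, Hk, K3, K4, σ`.
# (659)∕(666)∕(747) write every profile letter as intrinsic letter × factor letter (`Σ_{z′}|A_{uz′}|σA_{uz′} ≤ αrσ`, `Σ_u|A_{uz′}|σA_{uz′} ≤ αcσ`)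
# under the one compatibility `σ_{vz′} ≤ ϑ₂(v,u)σA_{uz′}` (the triangle inequality for exponential weights).  THIS FILE substitutes them:
# (670)'s conclusion VERBATIM from (670)'s non-profile hypotheses + the factor's two weighted letters + the intrinsic `ϑ₂`-letters the
# profiles consume (slot shapes; converted to (666)∕(738)'s mass shapes by (747)) + the scalar bookkeeping `intrinsic × factor ≤ letter`
# (`hrϑ·αrσ ≤ αθ`, `k3rϑ·αrσ ≤ αθ`, `k4ϑ1·αrσ ≤ αθ`, `αθ ≤ βθ`, `hcϑ·αcσ ≤ αθc`, …) — «ϑ₂-letters + factor letters in ⟹ ϑ-letters out», NO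
# profile hypothesis, no support count, no range (row NE7b, node U5c; (670), (659)∕(666)∕(747) BY NAME; [folklore]).  With (748)–(762) the
# weighted class map of row NE7b is a CLOSED one-step statement at orders 2–5 modulo the rate bookkeeping (672)∕(746).

Cell `pub-balaban`, sub-cell `t4`, spine estimate NE7b (`T4WeightBudget.RelWeightBound`; the cell's OWN estimate — NOT PRINTED in
[Bałaban 1983–89], NOT PROVED).  Crux-route work under `Spine/NE7b/` by the row OWNER (`t4-ne7b-p1` gen 147, file (754)) under FREEZE
(0)'s crux-prover clause; NOTHING of Bałaban's is named as a Lean object, valued or asserted; no `T4Continuum/Support` leaf typed; no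
`def`, no notation (the display and the bound WRITTEN OUT exactly as printed by the source file); zero `sorry`.  Imports (BY NAME): the
source file `…SupWeightedFourthOrderOutputFour`, (659) `…SupWeightedFamilyProfiles`, (666) `…SupWeightedFamilyProfilesK4`,
(747) `…SupWeightedProfileDischarge`.

WHAT IS PROVED ([folklore]): **`classmap_four_t`**; toy.

HONEST (what this is NOT).  One block of the per-order packaging (the other roles ∕ orders are the sibling files (748)–(762)); the
derivative∕continuity slots of the class carry no profile letter and are not restated; finite-torus Gaussian measure `μ_{AAᵀ}` with the
road's regularisation; the rates (which weights a scale admits, `L > 64` at order 4, `L > 384` at order 5 with the convenience exponents) are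
(672)∕(746); scalar skeleton ((A3), NC-NE7b-α UNRULED); nothing of Bałaban's asserted.  BY-NAME EFFECT ON THE WALL: NONE.  NE7b NOT PRINTED ∕
NOT PROVED; spine PROVED 0∕9; rung (B)+1 — the programme's measures remain FINITE-torus statements; NOT the mass gap, NOT Clay.  HONEST
DEPENDENCY: continuum YM on T⁴ ⇐ BetaPertH ∧ nine spine estimates (0∕9 proved); BetaPertH ⇐ (D1) ∧ (D4) ∧ CAP+tail; G-an2-4 gates asym,
D1 and NE2∕3∕4.
-/

set_option autoImplicit false
set_option maxSynthPendingDepth 3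

noncomputable section

namespace Summit.QuantumFields.BalabanUV.T4Continuum.NE7b.SupWeightedClassMapOrderFourFour

open MeasureTheory ProbabilityTheory Finset Real Matrix
open scoped BigOperators Matrix
open SupWeightedFourthOrderOutputFour (fourth_derivative_weighted_slot_t)
open SupWeightedFamilyProfiles (hk_profile_row hk_profile_col k3_mass_first k3_mass_second k3_col_internal)
open SupWeightedFamilyProfilesK4 (k4_mass_1 k4_mass_2 k4_mass_3 k4_col_internal)
open SupWeightedProfileDischarge (hk_profile_point k3_profile_point k4_profile_point k3_profile_row k4_profile_row hk_row_of_slot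
  hk_col_of_slot k4_mass_shape_1 k4_mass_shape_2 k4_mass_shape_3 k5_mass_shape_1 k5_mass_shape_2 k5_mass_shape_3 k5_mass_shape_4 letter_nonneg₁
  letter_nonneg₂ letter_nonneg₃ letter_nonneg₄)

variable {ι κ : Type} [Fintype ι] [DecidableEq ι] [Fintype κ] [DecidableEq κ]
variable {U : EuclideanSpace ℝ ι → ℝ} {U' : EuclideanSpace ℝ ι → EuclideanSpace ℝ ι →L[ℝ] ℝ}
  {U'' : EuclideanSpace ℝ ι → EuclideanSpace ℝ ι →L[ℝ] EuclideanSpace ℝ ι →L[ℝ] ℝ}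
  {U₃ : EuclideanSpace ℝ ι → EuclideanSpace ℝ ι →L[ℝ] EuclideanSpace ℝ ι →L[ℝ] EuclideanSpace ℝ ι →L[ℝ] ℝ}
  {U₄ : EuclideanSpace ℝ ι → EuclideanSpace ℝ ι →L[ℝ] EuclideanSpace ℝ ι →L[ℝ] EuclideanSpace ℝ ι →L[ℝ] EuclideanSpace ℝ ι →L[ℝ] ℝ}
  {Hk : ι → ι → ℝ} {K3 : ι → ι → ι → ℝ} {K4 : ι → ι → ι → ι → ℝ} {A : Matrix ι κ ℝ} {D : κ → κ → ℝ}
  {γop κ₀ κ₁ κ₂ κ₃ κ₄ a τ δ θp lam lamA αr αc hr γ dθ dθ' αθ βθ : ℝ} {θ : κ → κ → ℝ} {σ : ι → κ → ℝ} {ρ r : ι → ι → ℝ}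
  {ϑ ϑ₂ : ι → ι → ℝ} {αθc αg1m αg2m αg1c αk4m1 αk4m2 αk4m3 αk4c hrϑ hcϑ G Θ6 S4 k4ϑ1 k4ϑ2 k4ϑ3 k4ϑ4 : ℝ}
variable {σA : ι → κ → ℝ} {αrσ αcσ : ℝ}
variable {k3rϑ k3mϑ k3cϑ : ℝ}

set_option maxHeartbeats 800000 in
/-- **ORDER 4, DERIVATIVE SLOT `t` — THE WEIGHTED CLASS MAP PACKAGED**: for every background `ψ` and site `t`, the fourth `ψ`-derivative
entries of the one-step effective action `W⁺(ψ) = −log∫e^{−U(·+ψ)}dμ_{AAᵀ}` summed over the free slots against the full-graph weight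
`Πϑ` obey (670)'s bound — the weighted OUTPUT slot letter of `K4⁺ := |∂⁴W⁺|` in role `t` — from the road's step data, the weights'
compatibilities and geometry letters, the INPUT's intrinsic `ϑ₂`-letters (slot shapes), the factor's weighted letters `αrσ, αcσ` under
`σ_{vz′} ≤ ϑ₂(v,u)σA_{uz′}`, and the scalar bookkeeping `intrinsic × factor ≤ profile letter`; NO profile hypothesis ((659)∕(666)∕(747)
discharge them inside). [folklore] -/
theorem classmap_four_t [Nonempty κ] (hΓop : (γop • (1 : Matrix ι ι ℝ) - A * Aᵀ).PosSemidef) (Y : Finset ι)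
    (hUd : ∀ φ : EuclideanSpace ℝ ι, HasFDerivAt U (U' φ) φ) (hU'd : ∀ φ : EuclideanSpace ℝ ι, HasFDerivAt U' (U'' φ) φ)
    (hU''d : ∀ φ : EuclideanSpace ℝ ι, HasFDerivAt U'' (U₃ φ) φ) (hU₃d : ∀ φ : EuclideanSpace ℝ ι, HasFDerivAt U₃ (U₄ φ) φ) (hU₄c : Continuous U₄)
    (hκ₀ : 0 ≤ κ₀) (hκ₁ : 0 ≤ κ₁) (ha : 0 ≤ a) (hτ : 0 < τ) (hδ : 0 < δ) (hθ0 : 0 < θp) (hθ1 : θp < 1) (hκθ : (2 * κ₀ * (1 + τ) + 4 * δ) * γop ≤ θp)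
    (hκθw : 2 * κ₀ * (1 + τ) * γop + 4 * δ ≤ θp) (hstab : ∀ φ : EuclideanSpace ℝ ι, -(κ₀ * ∑ x ∈ Y, φ x ^ 2) ≤ U φ)
    (hU'b : ∀ φ : EuclideanSpace ℝ ι, ‖U' φ‖ ≤ κ₁ * (a + ∑ x ∈ Y, φ x ^ 2)) (hU''b : ∀ φ : EuclideanSpace ℝ ι, ‖U'' φ‖ ≤ κ₂)
    (hU₃b : ∀ φ : EuclideanSpace ℝ ι, ‖U₃ φ‖ ≤ κ₃) (hU₄b : ∀ φ : EuclideanSpace ℝ ι, ‖U₄ φ‖ ≤ κ₄) (hlam : 0 ≤ lam)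
    (hUsec : ∀ s : ℝ, 0 ≤ s → s ≤ 1 → ∀ a b : EuclideanSpace ℝ ι, U ((1 - s) • a + s • b) - lam / 2 * (s * (1 - s)) * ∑ i, (a i - b i) ^ 2 ≤ (1 - s)
      * U a + s * U b) (hρg : lam * γop < 1)
    (hHk : ∀ (φ : EuclideanSpace ℝ ι) (x z : ι), |U'' φ (EuclideanSpace.single z (1 : ℝ)) (EuclideanSpace.single x (1 : ℝ))| ≤ Hk x z)
    (hHk0 : ∀ v u, 0 ≤ Hk v u)
    (hK3 : ∀ (φ : EuclideanSpace ℝ ι) (u x y : ι), |U₃ φ (EuclideanSpace.single u (1 : ℝ)) (EuclideanSpace.single x (1 : ℝ))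
      (EuclideanSpace.single y (1 : ℝ))| ≤ K3 x y u) (hK30 : ∀ x y u, 0 ≤ K3 x y u)
    (hK4 : ∀ (φ : EuclideanSpace ℝ ι) (u x y z : ι), |U₄ φ (EuclideanSpace.single u (1 : ℝ)) (EuclideanSpace.single x (1 : ℝ))
      (EuclideanSpace.single y (1 : ℝ)) (EuclideanSpace.single z (1 : ℝ))| ≤ K4 x y z u) (hhr : ∀ v, ∑ u, Hk v u ≤ hr) (ψ : EuclideanSpace ℝ ι)
    (hαr : ∀ u, ∑ w, |A u w| ≤ αr) (hαc : ∀ w, ∑ u, |A u w| ≤ αc) (hlamA : ∀ x : κ, ∑ u, ∑ v, |A u x| * |A v x| * Hk v u ≤ lamA) (hlamA1 : lamA < 1)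
    (hγ : αc * hr * αr / (1 - lamA) ≤ γ) (hγ1 : γ < 1) (hD : ∀ x y, 0 ≤ D x y)
    (hDC : ∀ x y, (if x = y then (1 : ℝ) else 0) + ∑ z, D x z * ((if y = z then 0 else ∑ u, ∑ v, |A u y| * |A v z| * Hk v u) / (1 - lamA)) ≤ D x y)
    (hθnn : ∀ z w, 0 ≤ θ z w) (hDθr : ∀ z, ∑ w, D z w * θ z w ≤ dθ) (hdθ : 0 ≤ dθ) (hDθc : ∀ w, ∑ z, D z w * θ z w ≤ dθ') (hdθ' : 0 ≤ dθ')
    (hσ0 : ∀ x w, 0 ≤ σ x w) (hσθ : ∀ x z w, σ x w ≤ σ x z * θ z w) (hρ1 : ∀ x y, 1 ≤ ρ x y) (hρsymm : ∀ x y, ρ x y = ρ y x)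
    (hρmul : ∀ x y z, ρ x z ≤ ρ x y * ρ y z) (hρσ : ∀ x y w, ρ x y ^ 8 ≤ σ x w * σ y w) (hr1 : ∀ x y, 1 ≤ r x y)
    (hrσ : ∀ x y w, r x y ^ 24 ≤ σ x w * σ y w) (hϑ1 : ∀ x y, 1 ≤ ϑ x y) (hϑsymm : ∀ x y, ϑ x y = ϑ y x) (hϑmul : ∀ x y z, ϑ x z ≤ ϑ x y * ϑ y z)
    (hϑ₂symm : ∀ x y, ϑ₂ x y = ϑ₂ y x) (hϑ3 : ∀ x y, ϑ x y ^ 3 ≤ ϑ₂ x y) (hϑσ : ∀ x y w, ϑ x y ^ 4 ≤ σ x w * σ y w)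
    (hG : ∀ a, ∑ b, ϑ a b ^ 4 / Real.sqrt (ρ a b) ≤ G) (hΘ : ∀ a, ∑ b, (ϑ a b ^ 3) ^ 2 / ϑ₂ a b ≤ Θ6) (hhrw : ∀ a, ∑ b, ϑ₂ a b * Hk a b ≤ hrϑ)
    (hhc : ∀ a, ∑ b, ϑ₂ a b * Hk b a ≤ hcϑ) (hrsymm : ∀ a b, r a b = r b a) (hS4 : ∀ u, ∑ v, ϑ u v ^ 4 * (r u v ^ 2)⁻¹ ≤ S4)
    (hC4 : 0 ≤
      (4 * (αθ * dθ * (βθ * dθ') / (1 - lamA)) + 3 * (αθ * dθ * (βθ * dθ') / (1 - lamA)) ^ 2 + 4 * (5 * (κ₂ ^ 4 * γop ^ 2) / (1 - lam * γop) ^ 2) +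
        4 * (50 * (κ₂ ^ 6 * γop ^ 3) / (1 - lam * γop) ^ 3) + 2 * (((5 * (κ₂ ^ 4 * γop ^ 2) / (1 - lam * γop) ^ 2) + 1) / 2) *
        ((((5 * (κ₂ ^ 4 * γop ^ 2) / (1 - lam * γop) ^ 2) + 1) / 2) + (5 * (κ₂ ^ 4 * γop ^ 2) / (1 - lam * γop) ^ 2))))
    (hk4 : ∀ t, ∑ x, ∑ y, ∑ z, K4 y z t x * (ϑ₂ x y * ϑ₂ x z * ϑ₂ x t * ϑ₂ y z * ϑ₂ y t * ϑ₂ z t) ≤ k4ϑ3)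
    (hσA0 : ∀ u z', 0 ≤ σA u z') (hσϑ₂ : ∀ v u z', σ v z' ≤ ϑ₂ v u * σA u z') (hAr : ∀ u, ∑ z', |A u z'| * σA u z' ≤ αrσ)
        (hAc : ∀ z', ∑ u, |A u z'| * σA u z' ≤ αcσ) (hαcσ0 : 0 ≤ αcσ) (hk3r : ∀ x, ∑ y, ∑ v, K3 x y v * (ϑ₂ x y * ϑ₂ x v * ϑ₂ y v) ≤ k3rϑ)
        (hk3m : ∀ y, ∑ x, ∑ v, K3 x y v * (ϑ₂ y x * ϑ₂ y v * ϑ₂ x v) ≤ k3mϑ) (hk3c : ∀ v, ∑ y, ∑ z, K3 y z v * (ϑ₂ v y * ϑ₂ v z * ϑ₂ y z) ≤ k3cϑ)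
        (hk4x : ∀ x, ∑ y, ∑ z, ∑ t, K4 y z t x * (ϑ₂ x y * ϑ₂ x z * ϑ₂ x t * ϑ₂ y z * ϑ₂ y t * ϑ₂ z t) ≤ k4ϑ4) (hαθ : hrϑ * αrσ ≤ αθ)
        (hαθ' : k3rϑ * αrσ ≤ αθ) (hαβ : αθ ≤ βθ) (hαθc : hcϑ * αcσ ≤ αθc) (hαg2m : k3mϑ * αrσ ≤ αg2m) (hαg1c : k3cϑ * αcσ ≤ αg1c)
        (hαk4m3 : k4ϑ3 * αrσ ≤ αk4m3) (hαk4c : k4ϑ4 * αcσ ≤ αk4c) (t : ι) :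
    ∑ x, ∑ y, ∑ z, |(∫ ω : EuclideanSpace ℝ ι, exp (-U (ω + ψ)) ∂(multivariateGaussian 0 (A * Aᵀ)))⁻¹ *
        (∫ ω : EuclideanSpace ℝ ι, exp (-U (ω + ψ)) * U₄ (ω + ψ) (EuclideanSpace.single x (1 : ℝ)) (EuclideanSpace.single y (1 : ℝ))
          (EuclideanSpace.single z (1 : ℝ)) (EuclideanSpace.single t (1 : ℝ)) ∂(multivariateGaussian 0 (A * Aᵀ))) -
        (((∫ ω : EuclideanSpace ℝ ι, exp (-U (ω + ψ)) ∂(multivariateGaussian 0 (A * Aᵀ)))⁻¹ *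
            (∫ ω : EuclideanSpace ℝ ι, exp (-U (ω + ψ)) *
              (U₃ (ω + ψ) (EuclideanSpace.single x (1 : ℝ)) (EuclideanSpace.single z (1 : ℝ)) (EuclideanSpace.single t (1 : ℝ)) * U' (ω + ψ)
                (EuclideanSpace.single y (1 : ℝ))) ∂(multivariateGaussian 0 (A * Aᵀ))) -
            ((∫ ω : EuclideanSpace ℝ ι, exp (-U (ω + ψ)) ∂(multivariateGaussian 0 (A * Aᵀ))) ^ 2)⁻¹ *
            ((∫ ω : EuclideanSpace ℝ ι, exp (-U (ω + ψ)) * U₃ (ω + ψ) (EuclideanSpace.single x (1 : ℝ)) (EuclideanSpace.single z (1 : ℝ))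
                (EuclideanSpace.single t (1 : ℝ)) ∂(multivariateGaussian 0 (A * Aᵀ))) *
              (∫ ω : EuclideanSpace ℝ ι, exp (-U (ω + ψ)) * U' (ω + ψ) (EuclideanSpace.single y (1 : ℝ)) ∂(multivariateGaussian 0 (A * Aᵀ))))) +
          ((∫ ω : EuclideanSpace ℝ ι, exp (-U (ω + ψ)) ∂(multivariateGaussian 0 (A * Aᵀ)))⁻¹ *
            (∫ ω : EuclideanSpace ℝ ι, exp (-U (ω + ψ)) *
              (U₃ (ω + ψ) (EuclideanSpace.single x (1 : ℝ)) (EuclideanSpace.single y (1 : ℝ)) (EuclideanSpace.single t (1 : ℝ)) * U' (ω + ψ)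
                (EuclideanSpace.single z (1 : ℝ))) ∂(multivariateGaussian 0 (A * Aᵀ))) -
            ((∫ ω : EuclideanSpace ℝ ι, exp (-U (ω + ψ)) ∂(multivariateGaussian 0 (A * Aᵀ))) ^ 2)⁻¹ *
            ((∫ ω : EuclideanSpace ℝ ι, exp (-U (ω + ψ)) * U₃ (ω + ψ) (EuclideanSpace.single x (1 : ℝ)) (EuclideanSpace.single y (1 : ℝ))
                (EuclideanSpace.single t (1 : ℝ)) ∂(multivariateGaussian 0 (A * Aᵀ))) *
              (∫ ω : EuclideanSpace ℝ ι, exp (-U (ω + ψ)) * U' (ω + ψ) (EuclideanSpace.single z (1 : ℝ)) ∂(multivariateGaussian 0 (A * Aᵀ))))) +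
          ((∫ ω : EuclideanSpace ℝ ι, exp (-U (ω + ψ)) ∂(multivariateGaussian 0 (A * Aᵀ)))⁻¹ *
            (∫ ω : EuclideanSpace ℝ ι, exp (-U (ω + ψ)) *
              (U₃ (ω + ψ) (EuclideanSpace.single x (1 : ℝ)) (EuclideanSpace.single y (1 : ℝ)) (EuclideanSpace.single z (1 : ℝ)) * U' (ω + ψ)
                (EuclideanSpace.single t (1 : ℝ))) ∂(multivariateGaussian 0 (A * Aᵀ))) -
            ((∫ ω : EuclideanSpace ℝ ι, exp (-U (ω + ψ)) ∂(multivariateGaussian 0 (A * Aᵀ))) ^ 2)⁻¹ *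
            ((∫ ω : EuclideanSpace ℝ ι, exp (-U (ω + ψ)) * U₃ (ω + ψ) (EuclideanSpace.single x (1 : ℝ)) (EuclideanSpace.single y (1 : ℝ))
                (EuclideanSpace.single z (1 : ℝ)) ∂(multivariateGaussian 0 (A * Aᵀ))) *
              (∫ ω : EuclideanSpace ℝ ι, exp (-U (ω + ψ)) * U' (ω + ψ) (EuclideanSpace.single t (1 : ℝ)) ∂(multivariateGaussian 0 (A * Aᵀ))))) +
          ((∫ ω : EuclideanSpace ℝ ι, exp (-U (ω + ψ)) ∂(multivariateGaussian 0 (A * Aᵀ)))⁻¹ *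
            (∫ ω : EuclideanSpace ℝ ι, exp (-U (ω + ψ)) *
              (U' (ω + ψ) (EuclideanSpace.single x (1 : ℝ)) * U₃ (ω + ψ) (EuclideanSpace.single y (1 : ℝ)) (EuclideanSpace.single z (1 : ℝ))
                (EuclideanSpace.single t (1 : ℝ))) ∂(multivariateGaussian 0 (A * Aᵀ))) -
            ((∫ ω : EuclideanSpace ℝ ι, exp (-U (ω + ψ)) ∂(multivariateGaussian 0 (A * Aᵀ))) ^ 2)⁻¹ *
            ((∫ ω : EuclideanSpace ℝ ι, exp (-U (ω + ψ)) * U' (ω + ψ) (EuclideanSpace.single x (1 : ℝ)) ∂(multivariateGaussian 0 (A * Aᵀ))) *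
              (∫ ω : EuclideanSpace ℝ ι, exp (-U (ω + ψ)) * U₃ (ω + ψ) (EuclideanSpace.single y (1 : ℝ)) (EuclideanSpace.single z (1 : ℝ))
                (EuclideanSpace.single t (1 : ℝ)) ∂(multivariateGaussian 0 (A * Aᵀ)))))) -
        (((∫ ω : EuclideanSpace ℝ ι, exp (-U (ω + ψ)) ∂(multivariateGaussian 0 (A * Aᵀ)))⁻¹ *
            (∫ ω : EuclideanSpace ℝ ι, exp (-U (ω + ψ)) *
              (U'' (ω + ψ) (EuclideanSpace.single x (1 : ℝ)) (EuclideanSpace.single y (1 : ℝ)) * U'' (ω + ψ) (EuclideanSpace.single z (1 : ℝ))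
                (EuclideanSpace.single t (1 : ℝ))) ∂(multivariateGaussian 0 (A * Aᵀ))) -
            ((∫ ω : EuclideanSpace ℝ ι, exp (-U (ω + ψ)) ∂(multivariateGaussian 0 (A * Aᵀ))) ^ 2)⁻¹ *
            ((∫ ω : EuclideanSpace ℝ ι, exp (-U (ω + ψ)) * U'' (ω + ψ) (EuclideanSpace.single x (1 : ℝ)) (EuclideanSpace.single y (1 : ℝ))
                ∂(multivariateGaussian 0 (A * Aᵀ))) *
              (∫ ω : EuclideanSpace ℝ ι, exp (-U (ω + ψ)) * U'' (ω + ψ) (EuclideanSpace.single z (1 : ℝ)) (EuclideanSpace.single t (1 : ℝ))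
                ∂(multivariateGaussian 0 (A * Aᵀ))))) +
          ((∫ ω : EuclideanSpace ℝ ι, exp (-U (ω + ψ)) ∂(multivariateGaussian 0 (A * Aᵀ)))⁻¹ *
            (∫ ω : EuclideanSpace ℝ ι, exp (-U (ω + ψ)) *
              (U'' (ω + ψ) (EuclideanSpace.single x (1 : ℝ)) (EuclideanSpace.single z (1 : ℝ)) * U'' (ω + ψ) (EuclideanSpace.single y (1 : ℝ))
                (EuclideanSpace.single t (1 : ℝ))) ∂(multivariateGaussian 0 (A * Aᵀ))) -
            ((∫ ω : EuclideanSpace ℝ ι, exp (-U (ω + ψ)) ∂(multivariateGaussian 0 (A * Aᵀ))) ^ 2)⁻¹ *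
            ((∫ ω : EuclideanSpace ℝ ι, exp (-U (ω + ψ)) * U'' (ω + ψ) (EuclideanSpace.single x (1 : ℝ)) (EuclideanSpace.single z (1 : ℝ))
                ∂(multivariateGaussian 0 (A * Aᵀ))) *
              (∫ ω : EuclideanSpace ℝ ι, exp (-U (ω + ψ)) * U'' (ω + ψ) (EuclideanSpace.single y (1 : ℝ)) (EuclideanSpace.single t (1 : ℝ))
                ∂(multivariateGaussian 0 (A * Aᵀ))))) +
          ((∫ ω : EuclideanSpace ℝ ι, exp (-U (ω + ψ)) ∂(multivariateGaussian 0 (A * Aᵀ)))⁻¹ *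
            (∫ ω : EuclideanSpace ℝ ι, exp (-U (ω + ψ)) *
              (U'' (ω + ψ) (EuclideanSpace.single x (1 : ℝ)) (EuclideanSpace.single t (1 : ℝ)) * U'' (ω + ψ) (EuclideanSpace.single y (1 : ℝ))
                (EuclideanSpace.single z (1 : ℝ))) ∂(multivariateGaussian 0 (A * Aᵀ))) -
            ((∫ ω : EuclideanSpace ℝ ι, exp (-U (ω + ψ)) ∂(multivariateGaussian 0 (A * Aᵀ))) ^ 2)⁻¹ *
            ((∫ ω : EuclideanSpace ℝ ι, exp (-U (ω + ψ)) * U'' (ω + ψ) (EuclideanSpace.single x (1 : ℝ)) (EuclideanSpace.single t (1 : ℝ))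
                ∂(multivariateGaussian 0 (A * Aᵀ))) *
              (∫ ω : EuclideanSpace ℝ ι, exp (-U (ω + ψ)) * U'' (ω + ψ) (EuclideanSpace.single y (1 : ℝ)) (EuclideanSpace.single z (1 : ℝ))
                ∂(multivariateGaussian 0 (A * Aᵀ)))))) +
        ((∫ ω : EuclideanSpace ℝ ι, exp (-U (ω + ψ)) ∂(multivariateGaussian 0 (A * Aᵀ)))⁻¹ *
          (∫ ω : EuclideanSpace ℝ ι, exp (-U (ω + ψ)) *
            ((U'' (ω + ψ) (EuclideanSpace.single x (1 : ℝ)) (EuclideanSpace.single y (1 : ℝ)) -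
                ((∫ ω : EuclideanSpace ℝ ι, exp (-U (ω + ψ)) ∂(multivariateGaussian 0 (A * Aᵀ)))⁻¹ *
                  (∫ ω : EuclideanSpace ℝ ι, exp (-U (ω + ψ)) * U'' (ω + ψ) (EuclideanSpace.single x (1 : ℝ)) (EuclideanSpace.single y (1 : ℝ))
                    ∂(multivariateGaussian 0 (A * Aᵀ))))) *
              (U' (ω + ψ) (EuclideanSpace.single z (1 : ℝ)) -
                ((∫ ω : EuclideanSpace ℝ ι, exp (-U (ω + ψ)) ∂(multivariateGaussian 0 (A * Aᵀ)))⁻¹ *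
                  (∫ ω : EuclideanSpace ℝ ι, exp (-U (ω + ψ)) * U' (ω + ψ) (EuclideanSpace.single z (1 : ℝ)) ∂(multivariateGaussian 0 (A * Aᵀ))))) *
              (U' (ω + ψ) (EuclideanSpace.single t (1 : ℝ)) -
                ((∫ ω : EuclideanSpace ℝ ι, exp (-U (ω + ψ)) ∂(multivariateGaussian 0 (A * Aᵀ)))⁻¹ *
                  (∫ ω : EuclideanSpace ℝ ι, exp (-U (ω + ψ)) * U' (ω + ψ) (EuclideanSpace.single t (1 : ℝ)) ∂(multivariateGaussian 0 (A * Aᵀ))))))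
            ∂(multivariateGaussian 0 (A * Aᵀ))) + (∫ ω : EuclideanSpace ℝ ι, exp (-U (ω + ψ)) ∂(multivariateGaussian 0 (A * Aᵀ)))⁻¹ *
          (∫ ω : EuclideanSpace ℝ ι, exp (-U (ω + ψ)) *
            ((U'' (ω + ψ) (EuclideanSpace.single x (1 : ℝ)) (EuclideanSpace.single z (1 : ℝ)) -
                ((∫ ω : EuclideanSpace ℝ ι, exp (-U (ω + ψ)) ∂(multivariateGaussian 0 (A * Aᵀ)))⁻¹ *
                  (∫ ω : EuclideanSpace ℝ ι, exp (-U (ω + ψ)) * U'' (ω + ψ) (EuclideanSpace.single x (1 : ℝ)) (EuclideanSpace.single z (1 : ℝ))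
                    ∂(multivariateGaussian 0 (A * Aᵀ))))) *
              (U' (ω + ψ) (EuclideanSpace.single y (1 : ℝ)) -
                ((∫ ω : EuclideanSpace ℝ ι, exp (-U (ω + ψ)) ∂(multivariateGaussian 0 (A * Aᵀ)))⁻¹ *
                  (∫ ω : EuclideanSpace ℝ ι, exp (-U (ω + ψ)) * U' (ω + ψ) (EuclideanSpace.single y (1 : ℝ)) ∂(multivariateGaussian 0 (A * Aᵀ))))) *
              (U' (ω + ψ) (EuclideanSpace.single t (1 : ℝ)) -
                ((∫ ω : EuclideanSpace ℝ ι, exp (-U (ω + ψ)) ∂(multivariateGaussian 0 (A * Aᵀ)))⁻¹ *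
                  (∫ ω : EuclideanSpace ℝ ι, exp (-U (ω + ψ)) * U' (ω + ψ) (EuclideanSpace.single t (1 : ℝ)) ∂(multivariateGaussian 0 (A * Aᵀ))))))
            ∂(multivariateGaussian 0 (A * Aᵀ))) + (∫ ω : EuclideanSpace ℝ ι, exp (-U (ω + ψ)) ∂(multivariateGaussian 0 (A * Aᵀ)))⁻¹ *
          (∫ ω : EuclideanSpace ℝ ι, exp (-U (ω + ψ)) *
            ((U'' (ω + ψ) (EuclideanSpace.single x (1 : ℝ)) (EuclideanSpace.single t (1 : ℝ)) -
                ((∫ ω : EuclideanSpace ℝ ι, exp (-U (ω + ψ)) ∂(multivariateGaussian 0 (A * Aᵀ)))⁻¹ *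
                  (∫ ω : EuclideanSpace ℝ ι, exp (-U (ω + ψ)) * U'' (ω + ψ) (EuclideanSpace.single x (1 : ℝ)) (EuclideanSpace.single t (1 : ℝ))
                    ∂(multivariateGaussian 0 (A * Aᵀ))))) *
              (U' (ω + ψ) (EuclideanSpace.single y (1 : ℝ)) -
                ((∫ ω : EuclideanSpace ℝ ι, exp (-U (ω + ψ)) ∂(multivariateGaussian 0 (A * Aᵀ)))⁻¹ *
                  (∫ ω : EuclideanSpace ℝ ι, exp (-U (ω + ψ)) * U' (ω + ψ) (EuclideanSpace.single y (1 : ℝ)) ∂(multivariateGaussian 0 (A * Aᵀ))))) *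
              (U' (ω + ψ) (EuclideanSpace.single z (1 : ℝ)) -
                ((∫ ω : EuclideanSpace ℝ ι, exp (-U (ω + ψ)) ∂(multivariateGaussian 0 (A * Aᵀ)))⁻¹ *
                  (∫ ω : EuclideanSpace ℝ ι, exp (-U (ω + ψ)) * U' (ω + ψ) (EuclideanSpace.single z (1 : ℝ)) ∂(multivariateGaussian 0 (A * Aᵀ))))))
            ∂(multivariateGaussian 0 (A * Aᵀ))) + (∫ ω : EuclideanSpace ℝ ι, exp (-U (ω + ψ)) ∂(multivariateGaussian 0 (A * Aᵀ)))⁻¹ *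
          (∫ ω : EuclideanSpace ℝ ι, exp (-U (ω + ψ)) *
            ((U' (ω + ψ) (EuclideanSpace.single x (1 : ℝ)) -
                ((∫ ω : EuclideanSpace ℝ ι, exp (-U (ω + ψ)) ∂(multivariateGaussian 0 (A * Aᵀ)))⁻¹ *
                  (∫ ω : EuclideanSpace ℝ ι, exp (-U (ω + ψ)) * U' (ω + ψ) (EuclideanSpace.single x (1 : ℝ)) ∂(multivariateGaussian 0 (A * Aᵀ))))) *
              (U'' (ω + ψ) (EuclideanSpace.single y (1 : ℝ)) (EuclideanSpace.single z (1 : ℝ)) -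
                ((∫ ω : EuclideanSpace ℝ ι, exp (-U (ω + ψ)) ∂(multivariateGaussian 0 (A * Aᵀ)))⁻¹ *
                  (∫ ω : EuclideanSpace ℝ ι, exp (-U (ω + ψ)) * U'' (ω + ψ) (EuclideanSpace.single y (1 : ℝ)) (EuclideanSpace.single z (1 : ℝ))
                    ∂(multivariateGaussian 0 (A * Aᵀ))))) *
              (U' (ω + ψ) (EuclideanSpace.single t (1 : ℝ)) -
                ((∫ ω : EuclideanSpace ℝ ι, exp (-U (ω + ψ)) ∂(multivariateGaussian 0 (A * Aᵀ)))⁻¹ *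
                  (∫ ω : EuclideanSpace ℝ ι, exp (-U (ω + ψ)) * U' (ω + ψ) (EuclideanSpace.single t (1 : ℝ)) ∂(multivariateGaussian 0 (A * Aᵀ))))))
            ∂(multivariateGaussian 0 (A * Aᵀ))) + (∫ ω : EuclideanSpace ℝ ι, exp (-U (ω + ψ)) ∂(multivariateGaussian 0 (A * Aᵀ)))⁻¹ *
          (∫ ω : EuclideanSpace ℝ ι, exp (-U (ω + ψ)) *
            ((U' (ω + ψ) (EuclideanSpace.single x (1 : ℝ)) -
                ((∫ ω : EuclideanSpace ℝ ι, exp (-U (ω + ψ)) ∂(multivariateGaussian 0 (A * Aᵀ)))⁻¹ *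
                  (∫ ω : EuclideanSpace ℝ ι, exp (-U (ω + ψ)) * U' (ω + ψ) (EuclideanSpace.single x (1 : ℝ)) ∂(multivariateGaussian 0 (A * Aᵀ))))) *
              (U'' (ω + ψ) (EuclideanSpace.single y (1 : ℝ)) (EuclideanSpace.single t (1 : ℝ)) -
                ((∫ ω : EuclideanSpace ℝ ι, exp (-U (ω + ψ)) ∂(multivariateGaussian 0 (A * Aᵀ)))⁻¹ *
                  (∫ ω : EuclideanSpace ℝ ι, exp (-U (ω + ψ)) * U'' (ω + ψ) (EuclideanSpace.single y (1 : ℝ)) (EuclideanSpace.single t (1 : ℝ))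
                    ∂(multivariateGaussian 0 (A * Aᵀ))))) *
              (U' (ω + ψ) (EuclideanSpace.single z (1 : ℝ)) -
                ((∫ ω : EuclideanSpace ℝ ι, exp (-U (ω + ψ)) ∂(multivariateGaussian 0 (A * Aᵀ)))⁻¹ *
                  (∫ ω : EuclideanSpace ℝ ι, exp (-U (ω + ψ)) * U' (ω + ψ) (EuclideanSpace.single z (1 : ℝ)) ∂(multivariateGaussian 0 (A * Aᵀ))))))
            ∂(multivariateGaussian 0 (A * Aᵀ))) + (∫ ω : EuclideanSpace ℝ ι, exp (-U (ω + ψ)) ∂(multivariateGaussian 0 (A * Aᵀ)))⁻¹ *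
          (∫ ω : EuclideanSpace ℝ ι, exp (-U (ω + ψ)) *
            ((U' (ω + ψ) (EuclideanSpace.single x (1 : ℝ)) -
                ((∫ ω : EuclideanSpace ℝ ι, exp (-U (ω + ψ)) ∂(multivariateGaussian 0 (A * Aᵀ)))⁻¹ *
                  (∫ ω : EuclideanSpace ℝ ι, exp (-U (ω + ψ)) * U' (ω + ψ) (EuclideanSpace.single x (1 : ℝ)) ∂(multivariateGaussian 0 (A * Aᵀ))))) *
              (U'' (ω + ψ) (EuclideanSpace.single z (1 : ℝ)) (EuclideanSpace.single t (1 : ℝ)) -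
                ((∫ ω : EuclideanSpace ℝ ι, exp (-U (ω + ψ)) ∂(multivariateGaussian 0 (A * Aᵀ)))⁻¹ *
                  (∫ ω : EuclideanSpace ℝ ι, exp (-U (ω + ψ)) * U'' (ω + ψ) (EuclideanSpace.single z (1 : ℝ)) (EuclideanSpace.single t (1 : ℝ))
                    ∂(multivariateGaussian 0 (A * Aᵀ))))) *
              (U' (ω + ψ) (EuclideanSpace.single y (1 : ℝ)) -
                ((∫ ω : EuclideanSpace ℝ ι, exp (-U (ω + ψ)) ∂(multivariateGaussian 0 (A * Aᵀ)))⁻¹ *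
                  (∫ ω : EuclideanSpace ℝ ι, exp (-U (ω + ψ)) * U' (ω + ψ) (EuclideanSpace.single y (1 : ℝ)) ∂(multivariateGaussian 0 (A * Aᵀ))))))
            ∂(multivariateGaussian 0 (A * Aᵀ)))) -
        ((∫ ω : EuclideanSpace ℝ ι, exp (-U (ω + ψ)) ∂(multivariateGaussian 0 (A * Aᵀ)))⁻¹ *
          (∫ ω : EuclideanSpace ℝ ι, exp (-U (ω + ψ)) *
            ((U' (ω + ψ) (EuclideanSpace.single x (1 : ℝ)) -
                ((∫ ω : EuclideanSpace ℝ ι, exp (-U (ω + ψ)) ∂(multivariateGaussian 0 (A * Aᵀ)))⁻¹ *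
                  (∫ ω : EuclideanSpace ℝ ι, exp (-U (ω + ψ)) * U' (ω + ψ) (EuclideanSpace.single x (1 : ℝ)) ∂(multivariateGaussian 0 (A * Aᵀ))))) *
              (U' (ω + ψ) (EuclideanSpace.single y (1 : ℝ)) -
                ((∫ ω : EuclideanSpace ℝ ι, exp (-U (ω + ψ)) ∂(multivariateGaussian 0 (A * Aᵀ)))⁻¹ *
                  (∫ ω : EuclideanSpace ℝ ι, exp (-U (ω + ψ)) * U' (ω + ψ) (EuclideanSpace.single y (1 : ℝ)) ∂(multivariateGaussian 0 (A * Aᵀ))))) *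
              (U' (ω + ψ) (EuclideanSpace.single z (1 : ℝ)) -
                ((∫ ω : EuclideanSpace ℝ ι, exp (-U (ω + ψ)) ∂(multivariateGaussian 0 (A * Aᵀ)))⁻¹ *
                  (∫ ω : EuclideanSpace ℝ ι, exp (-U (ω + ψ)) * U' (ω + ψ) (EuclideanSpace.single z (1 : ℝ)) ∂(multivariateGaussian 0 (A * Aᵀ))))) *
              (U' (ω + ψ) (EuclideanSpace.single t (1 : ℝ)) -
                ((∫ ω : EuclideanSpace ℝ ι, exp (-U (ω + ψ)) ∂(multivariateGaussian 0 (A * Aᵀ)))⁻¹ *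
                  (∫ ω : EuclideanSpace ℝ ι, exp (-U (ω + ψ)) * U' (ω + ψ) (EuclideanSpace.single t (1 : ℝ)) ∂(multivariateGaussian 0 (A * Aᵀ))))))
            ∂(multivariateGaussian 0 (A * Aᵀ))) -
          ((∫ ω : EuclideanSpace ℝ ι, exp (-U (ω + ψ)) ∂(multivariateGaussian 0 (A * Aᵀ)))⁻¹ *
            (∫ ω : EuclideanSpace ℝ ι, exp (-U (ω + ψ)) *
              ((U' (ω + ψ) (EuclideanSpace.single x (1 : ℝ)) -
                  ((∫ ω : EuclideanSpace ℝ ι, exp (-U (ω + ψ)) ∂(multivariateGaussian 0 (A * Aᵀ)))⁻¹ *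
                    (∫ ω : EuclideanSpace ℝ ι, exp (-U (ω + ψ)) * U' (ω + ψ) (EuclideanSpace.single x (1 : ℝ)) ∂(multivariateGaussian 0 (A * Aᵀ)))))
                *
                (U' (ω + ψ) (EuclideanSpace.single y (1 : ℝ)) -
                  ((∫ ω : EuclideanSpace ℝ ι, exp (-U (ω + ψ)) ∂(multivariateGaussian 0 (A * Aᵀ)))⁻¹ *
                    (∫ ω : EuclideanSpace ℝ ι, exp (-U (ω + ψ)) * U' (ω + ψ) (EuclideanSpace.single y (1 : ℝ)) ∂(multivariateGaussian 0 (A * Aᵀ))))))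
              ∂(multivariateGaussian 0 (A * Aᵀ)))) *
          ((∫ ω : EuclideanSpace ℝ ι, exp (-U (ω + ψ)) ∂(multivariateGaussian 0 (A * Aᵀ)))⁻¹ *
            (∫ ω : EuclideanSpace ℝ ι, exp (-U (ω + ψ)) *
              ((U' (ω + ψ) (EuclideanSpace.single z (1 : ℝ)) -
                  ((∫ ω : EuclideanSpace ℝ ι, exp (-U (ω + ψ)) ∂(multivariateGaussian 0 (A * Aᵀ)))⁻¹ *
                    (∫ ω : EuclideanSpace ℝ ι, exp (-U (ω + ψ)) * U' (ω + ψ) (EuclideanSpace.single z (1 : ℝ)) ∂(multivariateGaussian 0 (A * Aᵀ)))))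
                *
                (U' (ω + ψ) (EuclideanSpace.single t (1 : ℝ)) -
                  ((∫ ω : EuclideanSpace ℝ ι, exp (-U (ω + ψ)) ∂(multivariateGaussian 0 (A * Aᵀ)))⁻¹ *
                    (∫ ω : EuclideanSpace ℝ ι, exp (-U (ω + ψ)) * U' (ω + ψ) (EuclideanSpace.single t (1 : ℝ)) ∂(multivariateGaussian 0 (A * Aᵀ))))))
              ∂(multivariateGaussian 0 (A * Aᵀ)))) -
          ((∫ ω : EuclideanSpace ℝ ι, exp (-U (ω + ψ)) ∂(multivariateGaussian 0 (A * Aᵀ)))⁻¹ *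
            (∫ ω : EuclideanSpace ℝ ι, exp (-U (ω + ψ)) *
              ((U' (ω + ψ) (EuclideanSpace.single x (1 : ℝ)) -
                  ((∫ ω : EuclideanSpace ℝ ι, exp (-U (ω + ψ)) ∂(multivariateGaussian 0 (A * Aᵀ)))⁻¹ *
                    (∫ ω : EuclideanSpace ℝ ι, exp (-U (ω + ψ)) * U' (ω + ψ) (EuclideanSpace.single x (1 : ℝ)) ∂(multivariateGaussian 0 (A * Aᵀ)))))
                *
                (U' (ω + ψ) (EuclideanSpace.single z (1 : ℝ)) -
                  ((∫ ω : EuclideanSpace ℝ ι, exp (-U (ω + ψ)) ∂(multivariateGaussian 0 (A * Aᵀ)))⁻¹ *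
                    (∫ ω : EuclideanSpace ℝ ι, exp (-U (ω + ψ)) * U' (ω + ψ) (EuclideanSpace.single z (1 : ℝ)) ∂(multivariateGaussian 0 (A * Aᵀ))))))
              ∂(multivariateGaussian 0 (A * Aᵀ)))) *
          ((∫ ω : EuclideanSpace ℝ ι, exp (-U (ω + ψ)) ∂(multivariateGaussian 0 (A * Aᵀ)))⁻¹ *
            (∫ ω : EuclideanSpace ℝ ι, exp (-U (ω + ψ)) *
              ((U' (ω + ψ) (EuclideanSpace.single y (1 : ℝ)) -
                  ((∫ ω : EuclideanSpace ℝ ι, exp (-U (ω + ψ)) ∂(multivariateGaussian 0 (A * Aᵀ)))⁻¹ *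
                    (∫ ω : EuclideanSpace ℝ ι, exp (-U (ω + ψ)) * U' (ω + ψ) (EuclideanSpace.single y (1 : ℝ)) ∂(multivariateGaussian 0 (A * Aᵀ)))))
                *
                (U' (ω + ψ) (EuclideanSpace.single t (1 : ℝ)) -
                  ((∫ ω : EuclideanSpace ℝ ι, exp (-U (ω + ψ)) ∂(multivariateGaussian 0 (A * Aᵀ)))⁻¹ *
                    (∫ ω : EuclideanSpace ℝ ι, exp (-U (ω + ψ)) * U' (ω + ψ) (EuclideanSpace.single t (1 : ℝ)) ∂(multivariateGaussian 0 (A * Aᵀ))))))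
              ∂(multivariateGaussian 0 (A * Aᵀ)))) -
          ((∫ ω : EuclideanSpace ℝ ι, exp (-U (ω + ψ)) ∂(multivariateGaussian 0 (A * Aᵀ)))⁻¹ *
            (∫ ω : EuclideanSpace ℝ ι, exp (-U (ω + ψ)) *
              ((U' (ω + ψ) (EuclideanSpace.single x (1 : ℝ)) -
                  ((∫ ω : EuclideanSpace ℝ ι, exp (-U (ω + ψ)) ∂(multivariateGaussian 0 (A * Aᵀ)))⁻¹ *
                    (∫ ω : EuclideanSpace ℝ ι, exp (-U (ω + ψ)) * U' (ω + ψ) (EuclideanSpace.single x (1 : ℝ)) ∂(multivariateGaussian 0 (A * Aᵀ)))))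
                *
                (U' (ω + ψ) (EuclideanSpace.single t (1 : ℝ)) -
                  ((∫ ω : EuclideanSpace ℝ ι, exp (-U (ω + ψ)) ∂(multivariateGaussian 0 (A * Aᵀ)))⁻¹ *
                    (∫ ω : EuclideanSpace ℝ ι, exp (-U (ω + ψ)) * U' (ω + ψ) (EuclideanSpace.single t (1 : ℝ)) ∂(multivariateGaussian 0 (A * Aᵀ))))))
              ∂(multivariateGaussian 0 (A * Aᵀ)))) *
          ((∫ ω : EuclideanSpace ℝ ι, exp (-U (ω + ψ)) ∂(multivariateGaussian 0 (A * Aᵀ)))⁻¹ *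
            (∫ ω : EuclideanSpace ℝ ι, exp (-U (ω + ψ)) *
              ((U' (ω + ψ) (EuclideanSpace.single y (1 : ℝ)) -
                  ((∫ ω : EuclideanSpace ℝ ι, exp (-U (ω + ψ)) ∂(multivariateGaussian 0 (A * Aᵀ)))⁻¹ *
                    (∫ ω : EuclideanSpace ℝ ι, exp (-U (ω + ψ)) * U' (ω + ψ) (EuclideanSpace.single y (1 : ℝ)) ∂(multivariateGaussian 0 (A * Aᵀ)))))
                *
                (U' (ω + ψ) (EuclideanSpace.single z (1 : ℝ)) -
                  ((∫ ω : EuclideanSpace ℝ ι, exp (-U (ω + ψ)) ∂(multivariateGaussian 0 (A * Aᵀ)))⁻¹ *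
                    (∫ ω : EuclideanSpace ℝ ι, exp (-U (ω + ψ)) * U' (ω + ψ) (EuclideanSpace.single z (1 : ℝ)) ∂(multivariateGaussian 0 (A * Aᵀ))))))
              ∂(multivariateGaussian 0 (A * Aᵀ)))))| * (ϑ x y * ϑ x z * ϑ x t * ϑ y z * ϑ y t * ϑ z t) ≤ k4ϑ3 + dθ * αk4m3 * (dθ' * αθc) /
        (1 - lamA) + dθ * αk4m3 * (dθ' * αθc) / (1 - lamA) + dθ * αθ * (dθ' * αk4c) / (1 - lamA) + dθ * αk4m3 * (dθ' * αθc) / (1 - lamA) + dθ * αg2m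
        * (dθ' * αg1c) / (1 - lamA) + dθ * αg2m * (dθ' * αg1c) / (1 - lamA) + dθ * αg2m * (dθ' * αg1c) / (1 - lamA) + Real.sqrt
        (2 * Real.sqrt (5 * (κ₂ ^ 4 * γop ^ 2) / (1 - lam * γop) ^ 2) *
          (4 * Real.sqrt ((5 * ((κ₂ ^ 4 + κ₃ ^ 4) * γop ^ 2) / (1 - lam * γop) ^ 2) * (αθ * dθ * (βθ * dθ') / (1 - lamA))))) *
        (G * (Real.sqrt (hcϑ * Θ6) * G)) + Real.sqrt
        (2 * Real.sqrt (5 * (κ₂ ^ 4 * γop ^ 2) / (1 - lam * γop) ^ 2) *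
          (4 * Real.sqrt ((5 * ((κ₂ ^ 4 + κ₃ ^ 4) * γop ^ 2) / (1 - lam * γop) ^ 2) * (αθ * dθ * (βθ * dθ') / (1 - lamA))))) *
        (G * (G * Real.sqrt (hcϑ * Θ6))) + Real.sqrt
        (2 * Real.sqrt (5 * (κ₂ ^ 4 * γop ^ 2) / (1 - lam * γop) ^ 2) *
          (4 * Real.sqrt ((5 * ((κ₂ ^ 4 + κ₃ ^ 4) * γop ^ 2) / (1 - lam * γop) ^ 2) * (αθ * dθ * (βθ * dθ') / (1 - lamA))))) *
        (Real.sqrt (hrϑ * Θ6) * (G * G)) + Real.sqrt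
        (2 * Real.sqrt (5 * (κ₂ ^ 4 * γop ^ 2) / (1 - lam * γop) ^ 2) *
          (4 * Real.sqrt ((5 * ((κ₂ ^ 4 + κ₃ ^ 4) * γop ^ 2) / (1 - lam * γop) ^ 2) * (αθ * dθ * (βθ * dθ') / (1 - lamA))))) *
        (G * (G * Real.sqrt (hcϑ * Θ6))) + Real.sqrt
        (2 * Real.sqrt (5 * (κ₂ ^ 4 * γop ^ 2) / (1 - lam * γop) ^ 2) *
          (4 * Real.sqrt ((5 * ((κ₂ ^ 4 + κ₃ ^ 4) * γop ^ 2) / (1 - lam * γop) ^ 2) * (αθ * dθ * (βθ * dθ') / (1 - lamA))))) *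
        (Real.sqrt (hrϑ * Θ6) * (G * G)) + Real.sqrt
        (2 * Real.sqrt (5 * (κ₂ ^ 4 * γop ^ 2) / (1 - lam * γop) ^ 2) *
          (4 * Real.sqrt ((5 * ((κ₂ ^ 4 + κ₃ ^ 4) * γop ^ 2) / (1 - lam * γop) ^ 2) * (αθ * dθ * (βθ * dθ') / (1 - lamA))))) *
        (Real.sqrt (hrϑ * Θ6) * (G * G)) +
        (4 * (αθ * dθ * (βθ * dθ') / (1 - lamA)) + 3 * (αθ * dθ * (βθ * dθ') / (1 - lamA)) ^ 2 + 4 * (5 * (κ₂ ^ 4 * γop ^ 2) / (1 - lam * γop) ^ 2)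
          + 4 * (50 * (κ₂ ^ 6 * γop ^ 3) / (1 - lam * γop) ^ 3) + 2 * (((5 * (κ₂ ^ 4 * γop ^ 2) / (1 - lam * γop) ^ 2) + 1) / 2) *
          ((((5 * (κ₂ ^ 4 * γop ^ 2) / (1 - lam * γop) ^ 2) + 1) / 2) + (5 * (κ₂ ^ 4 * γop ^ 2) / (1 - lam * γop) ^ 2))) * (16 * S4 ^ 3) := by
  have hϑ₂1 : ∀ i j, 1 ≤ ϑ₂ i j := fun i j => ((hϑ1 i j).trans (le_self_pow₀ (hϑ1 i j) (by norm_num))).trans (hϑ3 i j)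
  have hϑ₂0 : ∀ i j, 0 ≤ ϑ₂ i j := fun i j => zero_le_one.trans (hϑ₂1 i j)
  have hK40 : ∀ i j k u, 0 ≤ K4 i j k u := fun i j k u => (abs_nonneg _).trans (hK4 0 u i j k)
  have hαrσ0 : 0 ≤ αrσ := (sum_nonneg fun z' _ => mul_nonneg (abs_nonneg _) (hσA0 t z')).trans (hAr t)
  have hhr0 : 0 ≤ hrϑ := letter_nonneg₁ (fun j => mul_nonneg (hϑ₂0 t j) (hHk0 t j)) (hhrw t)
  have hhc0 : 0 ≤ hcϑ := letter_nonneg₁ (fun j => mul_nonneg (hϑ₂0 t j) (hHk0 j t)) (hhc t)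
  have hk3c0 : 0 ≤ k3cϑ := letter_nonneg₂ (fun i j => mul_nonneg (hK30 i j t) (mul_nonneg (mul_nonneg (hϑ₂0 t i) (hϑ₂0 t j)) (hϑ₂0 i j))) (hk3c t)
  have hk4x0 : 0 ≤ k4ϑ4 := letter_nonneg₃
      (fun i j k => mul_nonneg (hK40 i j k t)
        (mul_nonneg (mul_nonneg (mul_nonneg (mul_nonneg (mul_nonneg (hϑ₂0 t i) (hϑ₂0 t j)) (hϑ₂0 t k)) (hϑ₂0 i j)) (hϑ₂0 i k)) (hϑ₂0 j k))) (hk4x t)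
  have haσX : ∀ v : ι, ∑ w, (∑ u, |A u w| * Hk v u) * σ v w ≤ αθ := fun p => (hk_profile_row hHk0 hϑ₂0 hσϑ₂ hAr hαrσ0 (hk_row_of_slot hhrw) p).trans
      hαθ
  have haσ'X : ∀ (v : ι) (w : κ), (∑ u, |A u w| * Hk v u) * σ v w ≤ βθ := fun p q => (hk_profile_point hHk0 hσ0 haσX p q).trans hαβ
  have hβX : 0 ≤ βθ := ((mul_nonneg hhr0 hαrσ0).trans hαθ).trans hαβ
  have hgσX : ∀ x y : ι, ∑ w, (∑ u, |A u w| * K3 x y u) * σ x w ≤ αθ := fun p q => (k3_profile_row hK30 hϑ₂1 hσϑ₂ hAr hαrσ0 hk3r p q).trans hαθ'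
  have hgσ'X : ∀ (x y : ι) (w : κ), (∑ u, |A u w| * K3 x y u) * σ x w ≤ βθ := fun p q o => (k3_profile_point hK30 hσ0 hgσX p q o).trans hαβ
  have hbσcX : ∀ z', ∑ v, (∑ u, |A u z'| * Hk v u) * σ v z' ≤ αθc := fun p =>
      (hk_profile_col hHk0 hσA0 hσϑ₂ hAc (hk_col_of_slot hϑ₂symm hhc) hhc0 p).trans hαθc
  have hαθcX : 0 ≤ αθc := (mul_nonneg hhc0 hαcσ0).trans hαθc
  have hg2mX : ∀ y, ∑ x, ϑ₂ y x * ∑ z', (∑ u, |A u z'| * K3 x y u) * σ y z' ≤ αg2m := fun p =>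
      (k3_mass_second hK30 hϑ₂1 hσA0 hσϑ₂ hAr hαrσ0 hk3m p).trans hαg2m
  have hg1cX : ∀ z', ∑ x, ∑ y, (∑ u, |A u z'| * K3 x y u) * (σ x z' * ϑ₂ x y) ≤ αg1c := fun p =>
      (k3_col_internal hK30 hϑ₂1 hϑ₂symm hσA0 hσϑ₂ hAc hk3c hk3c0 p).trans hαg1c
  have hαg1cX : 0 ≤ αg1c := (mul_nonneg hk3c0 hαcσ0).trans hαg1c
  have hk4m3X : ∀ s, ∑ p, ∑ q, (ϑ₂ s p * ϑ₂ s q * ϑ₂ p q) * ∑ z', (∑ u, |A u z'| * K4 p q s u) * σ s z' ≤ αk4m3 := fun p =>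
      (k4_mass_3 hK40 hϑ₂1 hσA0 hσϑ₂ hAr hαrσ0 (k4_mass_shape_3 hϑ₂symm hk4) p).trans hαk4m3
  have hk4cX : ∀ z', ∑ a, ∑ b, ∑ c, (∑ u, |A u z'| * K4 a b c u) * (σ a z' * (ϑ₂ a b * ϑ₂ a c * ϑ₂ b c)) ≤ αk4c := fun p =>
      (k4_col_internal hK40 hϑ₂1 hϑ₂symm hσA0 hσϑ₂ hAc hk4x hk4x0 p).trans hαk4c
  have hαk4cX : 0 ≤ αk4c := (mul_nonneg hk4x0 hαcσ0).trans hαk4c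
  exact fourth_derivative_weighted_slot_t hΓop Y hUd hU'd hU''d hU₃d hU₄c hκ₀ hκ₁ ha hτ hδ hθ0 hθ1 hκθ hκθw hstab hU'b hU''b hU₃b hU₄b hlam hUsec
      hρg hHk hHk0 hK3 hK30 hK4 hhr ψ hαr hαc hlamA hlamA1 hγ hγ1 hD hDC hθnn hDθr hdθ hDθc hdθ' hσ0 hσθ hρ1 hρsymm hρmul hρσ hr1 hrσ haσX hβX haσ'X
      hgσX hgσ'X hϑ1 hϑsymm hϑmul hϑ₂symm hϑ3 hϑσ hG hΘ hhrw hhc hrsymm hS4 hC4 hbσcX hαθcX hg2mX hg1cX hαg1cX hk4m3X hk4cX hαk4cX hk4 t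

/-! ## Toy -/

/-- Toy (the bookkeeping in numbers): an intrinsic letter `2` and a factor letter `3` admit any profile letter `≥ 6`. -/
example : (2 : ℝ) * 3 ≤ 6 := by norm_num

end Summit.QuantumFields.BalabanUV.T4Continuum.NE7b.SupWeightedClassMapOrderFourFour

end
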